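/-
Origin: expansion seat `planner-pub-hodgecm-toy-g2-0`, handover #11 2026-08-18T07:22:53Z (`HOME/pub-hodgecm-toy-g2/lean/ToyG2/Trace.lean`, md5 b617b8d9, 257 lines);
landed by the gen-7 packager in gate run 26 as `HodgeCM/Model/ToyG2/Trace.lean` (import ^import ToyG2\.→import HodgeCM.Model.ToyG2. ×1).
-/
/-
Copyright (c) 2026. All rights reserved.
Released under Apache 2.0 license as described in the file LICENSE.
-/
import Mathlib
import Summits.HodgeConjecture.HodgeCM.Model.ToyG2.Universe2
import Summits.HodgeConjecture.HodgeCM.Model.Toy.ToyTrTop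

/-!
# ToyG2.Trace — the Künneth trace system of the generation-2 universe

A concrete, genuinely nonzero trace system `traceSys : TraceSys` for `toyModel2With` (DESIGN.md §3, §7):

* every leaf carries a rational alternating form in its own degree `2 · pdim`: an atom `(F, Φ)` the
  determinant form of a fixed rational basis of `F` (an orientation of `⋀^{[F:ℚ]} F`, degree `[F:ℚ]`),
  a period block `(O, ℓ)` the prescribed functional `ℓ` on `⋀⁴ L(O)` (degree `4`, although `rank L(O)`
  may be larger — the block is a surface whose `H¹` is too big, and `ℓ` is its intersection form);
* the form of a variety (a shape of leaves) is the exterior product of the leaf forms, built structurally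
  along the shape with `AlternatingMap.domCoprod` (`prodForm`), in degree `sdeg = 2 · dim` (`sdeg_eq`);
* `traceSys.tr X k` is the induced functional on `⋀^k L(X)` for `k = 2 dim X` and `0` otherwise.

Proved here: the evaluation on pure wedges (`trOf_apply_ιMulti`), the single-block and single-atom
values (`trOf_pbObj`, `form_atom_ne_zero`), and the **Künneth multiplicativity on split pure wedges**
(`prodForm_append`, from the general evaluation `domCoprod_apply_of_fst_inr_eq_zero` of a `domCoprod` of
pulled-back forms on a block family: only the trivial shuffle class contributes).  With `Axioms2`,
`toyModel2With exteriorHodgeData traceSys pl` satisfies 27 of the 28 model axioms with honest traces.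
-/

namespace HodgeCM.ToyG2

open HodgeCM.Toy
open scoped TensorProduct
open exteriorPower Obj₂

noncomputable section

/-! ### §0 A `domCoprod` of pulled-back forms on a block family -/

/-- If the first factor's pull-back kills the second block of the family, only the trivial shuffle class
contributes to `domCoprod`: the value is the tensor of the two evaluations. -/
theorem domCoprod_apply_of_fst_inr_eq_zero {ιa ιb : Type*} [Fintype ιa] [Fintype ιb]
    [DecidableEq ιa] [DecidableEq ιb] {R : Type*} [CommRing R] {M P Q N₁ N₂ : Type*}
    [AddCommGroup M] [Module R M] [AddCommGroup P] [Module R P] [AddCommGroup Q] [Module R Q]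
    [AddCommGroup N₁] [Module R N₁] [AddCommGroup N₂] [Module R N₂]
    (α : P [⋀^ιa]→ₗ[R] N₁) (β : Q [⋀^ιb]→ₗ[R] N₂) (f : M →ₗ[R] P) (g : M →ₗ[R] Q)
    (v : ιa ⊕ ιb → M) (hf : ∀ j, f (v (Sum.inr j)) = 0) :
    (α.compLinearMap f).domCoprod (β.compLinearMap g) v
      = α (fun i => f (v (Sum.inl i))) ⊗ₜ[R] β (fun j => g (v (Sum.inr j))) := by
  change (⇑(∑ σ : Equiv.Perm.ModSumCongr ιa ιb,
    AlternatingMap.domCoprod.summand (α.compLinearMap f) (β.compLinearMap g) σ)) v = _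
  rw [_root_.sum_apply]
  refine (Fintype.sum_eq_single (Quotient.mk'' 1 : Equiv.Perm.ModSumCongr ιa ιb)
    (fun σ hσ => ?_)).trans ?_
  · induction σ using Quotient.inductionOn' with
    | h σ =>
      rw [AlternatingMap.domCoprod.summand_mk'', _root_.smul_apply,
        MultilinearMap.domDomCongr_apply, MultilinearMap.domCoprod_apply]
      have hex : ∃ i j, σ (Sum.inl i) = Sum.inr j := by
        by_contra hne
        push Not at hne
        apply hσ
        have hmem : σ ∈ (Equiv.Perm.sumCongrHom ιa ιb).range := by
          apply Equiv.Perm.mem_sumCongrHom_range_of_perm_mapsTo_inl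
          rintro _ ⟨i, rfl⟩
          rcases hx : σ (Sum.inl i) with i' | j
          · exact ⟨i', rfl⟩
          · exact absurd hx (hne i j)
        apply Quotient.sound'
        rw [QuotientGroup.leftRel_apply, mul_one]
        exact Subgroup.inv_mem _ hmem
      obtain ⟨i, j, hij⟩ := hex
      have hz : (↑(α.compLinearMap f) : MultilinearMap R (fun _ : ιa => M) N₁)
          (fun i' => v (σ (Sum.inl i'))) = 0 := by
        rw [AlternatingMap.coe_multilinearMap, AlternatingMap.compLinearMap_apply]
        exact α.map_coord_zero i (by simp [hij, hf j])
      rw [hz, TensorProduct.zero_tmul, smul_zero]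
  · rw [AlternatingMap.domCoprod.summand_mk'', Equiv.Perm.sign_one, one_smul,
      MultilinearMap.domDomCongr_apply, MultilinearMap.domCoprod_apply]
    rfl

/-! ### §1 Projections of a binary product of gen-1 objects; exterior product of forms -/

section Prod

variable (A B : Obj)

/-- restriction of `H¹(A × B) = L A ⊕ L B` to the `A`-coordinates -/
def fstL : (A.prod B).L →ₗ[ℚ] A.L := LinearMap.fst ℚ A.L B.L ∘ₗ (A.sumEquiv B).toLinearMap

/-- restriction of `H¹(A × B) = L A ⊕ L B` to the `B`-coordinates -/
def sndL : (A.prod B).L →ₗ[ℚ] B.L := LinearMap.snd ℚ A.L B.L ∘ₗ (A.sumEquiv B).toLinearMap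

/-- (Ported verbatim from the HodgeCMPerL package; no docstring in the source.) -/
@[simp] lemma fstL_inlL (x : A.L) : fstL A B (A.inlL B x) = x := by
  simp [fstL, Obj.inlL]

/-- (Ported verbatim from the HodgeCMPerL package; no docstring in the source.) -/
@[simp] lemma fstL_inrL (y : B.L) : fstL A B (A.inrL B y) = 0 := by
  simp [fstL, Obj.inrL]

/-- (Ported verbatim from the HodgeCMPerL package; no docstring in the source.) -/
@[simp] lemma sndL_inlL (x : A.L) : sndL A B (A.inlL B x) = 0 := by
  simp [sndL, Obj.inlL]

/-- (Ported verbatim from the HodgeCMPerL package; no docstring in the source.) -/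
@[simp] lemma sndL_inrL (y : B.L) : sndL A B (A.inrL B y) = y := by
  simp [sndL, Obj.inrL]

variable {A B}

/-- exterior product of an `m`-form on `L A` and an `n`-form on `L B`: an `(m+n)`-form on `L (A × B)` -/
def prodForm {m n : ℕ} (α : A.L [⋀^Fin m]→ₗ[ℚ] ℚ) (β : B.L [⋀^Fin n]→ₗ[ℚ] ℚ) :
    (A.prod B).L [⋀^Fin (m + n)]→ₗ[ℚ] ℚ :=
  ((TensorProduct.lid ℚ ℚ).toLinearMap.compAlternatingMap
    ((α.compLinearMap (fstL A B)).domCoprod (β.compLinearMap (sndL A B)))).domDomCongr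
      finSumFinEquiv

/-- **Künneth multiplicativity on split families**: the exterior product of forms evaluated on
`(x₁, …, x_m, y₁, …, y_n)` with `xᵢ ∈ L A`, `y_j ∈ L B` is `α(x) · β(y)`. -/
theorem prodForm_append {m n : ℕ} (α : A.L [⋀^Fin m]→ₗ[ℚ] ℚ) (β : B.L [⋀^Fin n]→ₗ[ℚ] ℚ)
    (x : Fin m → A.L) (y : Fin n → B.L) :
    prodForm α β (Fin.append (fun i => A.inlL B (x i)) (fun j => A.inrL B (y j))) = α x * β y := by
  have happ : (Fin.append (fun i => A.inlL B (x i)) (fun j => A.inrL B (y j))) ∘ finSumFinEquiv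
      = Sum.elim (fun i => A.inlL B (x i)) (fun j => A.inrL B (y j)) := by
    funext u
    rcases u with i | j
    · simp
    · simp
  rw [prodForm, AlternatingMap.domDomCongr_apply, happ, LinearMap.compAlternatingMap_apply,
    domCoprod_apply_of_fst_inr_eq_zero α β (fstL A B) (sndL A B) _ (fun j => by simp)]
  simp

end Prod

/-! ### §2 Leaf forms -/

/-- (Ported verbatim from the HodgeCMPerL package; no docstring in the source.) -/
lemma Atom.two_mul_half (a : Atom) :
    Module.finrank ℚ a.F = 2 * (Module.finrank ℚ a.F / 2) :=
  (Nat.two_mul_div_two_of_even (Atom.even_finrank a)).symm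

/-- a rational basis of the `H¹` of an atom leaf, indexed by `Fin (2 · pdim)` -/
def atomBasis (a : Atom) : Module.Basis (Fin (2 * (Module.finrank ℚ a.F / 2))) ℚ (Leaf.atom a).obj.L :=
  (Module.finBasisOfFinrankEq ℚ a.F (Atom.two_mul_half a)).map
    (LinearEquiv.funUnique Unit ℚ a.F).symm

/-- the form of a leaf in degree `2 · pdim`: an orientation (determinant form of `atomBasis`) for an
atom, the prescribed functional `ℓ` on `⋀⁴` for a period block -/
def Leaf.form : (l : Leaf) → (l.obj.L [⋀^Fin (2 * l.pdim)]→ₗ[ℚ] ℚ)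
  | .atom a => (atomBasis a).det
  | .pb p => p.ℓ.compAlternatingMap (ιMulti ℚ 4)

/-- (Ported verbatim from the HodgeCMPerL package; no docstring in the source.) -/
lemma form_atom_ne_zero (a : Atom) : (Leaf.atom a).form ≠ 0 := by
  intro h
  have h1 : (Leaf.atom a).form (atomBasis a) = 1 := (atomBasis a).det_self
  rw [h, AlternatingMap.zero_apply] at h1
  exact zero_ne_one h1

/-- (Ported verbatim from the HodgeCMPerL package; no docstring in the source.) -/
@[simp] lemma form_pb_apply (p : PLeaf) (v : Fin 4 → p.O.L) :
    (Leaf.pb p).form v = p.ℓ (ιMulti ℚ 4 v) := rfl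

/-! ### §3 The structural form and degree of a variety -/

/-- structural degree `2 · dim`, computed along the shape -/
def sdeg : (s : Shape) → (s.toType → Leaf) → ℕ
  | .empty, _ => 0
  | .unit, l => 2 * (l ()).pdim
  | .sum a b, l => sdeg a (fun u => l (Sum.inl u)) + sdeg b (fun u => l (Sum.inr u))

/-- structural form: the exterior product of the leaf forms along the shape -/
def sform : (s : Shape) → (l : s.toType → Leaf) → ((Obj₂.expand s l).L [⋀^Fin (sdeg s l)]→ₗ[ℚ] ℚ)
  | .empty, _ => AlternatingMap.constOfIsEmpty ℚ _ (Fin 0) 1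
  | .unit, l => (l ()).form
  | .sum a b, l => prodForm (sform a (fun u => l (Sum.inl u))) (sform b (fun u => l (Sum.inr u)))

/-- (Ported verbatim from the HodgeCMPerL package; no docstring in the source.) -/
lemma sdeg_eq_aux : ∀ (s : Shape) (l : s.toType → Leaf), sdeg s l = 2 * ∑ u, (l u).pdim
  | .empty, _ => by simp [sdeg]
  | .unit, l => by simp [sdeg]
  | .sum a b, l => by
      rw [sdeg, sdeg_eq_aux a, sdeg_eq_aux b, Fintype.sum_sum_type]
      ring

/-- (Ported verbatim from the HodgeCMPerL package; no docstring in the source.) -/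
lemma sdeg_eq (X : Obj₂) : sdeg X.s X.leaf = 2 * X.dim := sdeg_eq_aux X.s X.leaf

/-- the form of a variety, in degree `sdeg = 2 · dim` -/
def form (X : Obj₂) : X.L [⋀^Fin (sdeg X.s X.leaf)]→ₗ[ℚ] ℚ := sform X.s X.leaf

/-- (Ported verbatim from the HodgeCMPerL package; no docstring in the source.) -/
lemma form_prod (X Y : Obj₂) : form (X.prod Y) = prodForm (form X) (form Y) := rfl

/-! ### §4 The trace system -/

/-- the trace functional of `X` in degree `k`: the form of `X` if `k = 2 dim X`, else `0` -/
def trOf (X : Obj₂) (k : ℕ) : (↥(⋀[ℚ]^k X.L) →ₗ[ℚ] ℚ) :=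
  if h : sdeg X.s X.leaf = k then alternatingMapLinearEquiv ((form X).domDomCongr (finCongr h))
  else 0

/-- (Ported verbatim from the HodgeCMPerL package; no docstring in the source.) -/
lemma trOf_of_ne {X : Obj₂} {k : ℕ} (h : sdeg X.s X.leaf ≠ k) : trOf X k = 0 := dif_neg h

/-- (Ported verbatim from the HodgeCMPerL package; no docstring in the source.) -/
lemma trOf_apply_ιMulti {X : Obj₂} {k : ℕ} (h : sdeg X.s X.leaf = k) (v : Fin k → X.L) :
    trOf X k (ιMulti ℚ k v) = form X (v ∘ finCongr h) := by
  rw [trOf, dif_pos h, alternatingMapLinearEquiv_apply_ιMulti, AlternatingMap.domDomCongr_apply]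

/-- **the Künneth trace system** of the generation-2 universe -/
def traceSys : TraceSys where
  tr := trOf
  degree X k hk := trOf_of_ne (by rw [sdeg_eq]; exact fun h => hk h.symm)

/-- (Ported verbatim from the HodgeCMPerL package; no docstring in the source.) -/
@[simp] lemma traceSys_tr : traceSys.tr = trOf := rfl

/-! ### §5 Values on a single block, a single atom, and products -/

/-- (Ported verbatim from the HodgeCMPerL package; no docstring in the source.) -/
lemma sdeg_pbObj (p : PLeaf) : sdeg (pbObj p).s (pbObj p).leaf = 4 := rfl

/-- on the period surface `pbObj p` the degree-4 trace is the prescribed functional `ℓ` -/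
theorem trOf_pbObj (p : PLeaf) : trOf (pbObj p) 4 = p.ℓ := by
  apply exteriorPower.linearMap_ext
  ext v
  rw [LinearMap.compAlternatingMap_apply, LinearMap.compAlternatingMap_apply,
    trOf_apply_ιMulti (sdeg_pbObj p)]
  change (Leaf.pb p).form (v ∘ finCongr (sdeg_pbObj p)) = _
  rw [form_pb_apply]
  congr 1

/-- (Ported verbatim from the HodgeCMPerL package; no docstring in the source.) -/
lemma sdeg_atomObj (a : Atom) :
    sdeg (⟨.unit, fun _ => .atom a⟩ : Obj₂).s (⟨.unit, fun _ => .atom a⟩ : Obj₂).leaf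
      = 2 * (Module.finrank ℚ a.F / 2) := rfl

/-- on an atom the trace in degree `[F:ℚ]` is a nonzero orientation: it is `1` on the wedge of
`atomBasis` -/
theorem trOf_atom_basis (a : Atom) :
    trOf ⟨.unit, fun _ => .atom a⟩ (2 * (Module.finrank ℚ a.F / 2)) (ιMulti ℚ _ (atomBasis a)) = 1 := by
  rw [trOf_apply_ιMulti (sdeg_atomObj a)]
  have h : (⇑(atomBasis a) ∘ ⇑(finCongr (sdeg_atomObj a))) = atomBasis a :=
    funext fun i => congrArg (atomBasis a) (Fin.ext rfl)
  exact (congrArg (form (⟨.unit, fun _ => .atom a⟩ : Obj₂)) h).trans (atomBasis a).det_self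

/-- **Künneth multiplicativity of the trace on split pure wedges**:
`tr_{X×Y} (pr₁^* x₁ ∧ … ∧ pr₁^* x_m ∧ pr₂^* y₁ ∧ … ∧ pr₂^* y_n) = tr_X (x₁ ∧ … ∧ x_m) · tr_Y (y₁ ∧ … ∧ y_n)`
in the degrees `m = 2 dim X`, `n = 2 dim Y`. -/
theorem trOf_prod_append {X Y : Obj₂} {m n : ℕ} (hm : sdeg X.s X.leaf = m) (hn : sdeg Y.s Y.leaf = n)
    (x : Fin m → X.L) (y : Fin n → Y.L) :
    trOf (X.prod Y) (m + n)
        (ιMulti ℚ (m + n) (Fin.append (fun i => X.toObj.inlL Y.toObj (x i))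
          (fun j => X.toObj.inrL Y.toObj (y j))))
      = trOf X m (ιMulti ℚ m x) * trOf Y n (ιMulti ℚ n y) := by
  subst hm; subst hn
  have hmn : sdeg (X.prod Y).s (X.prod Y).leaf = sdeg X.s X.leaf + sdeg Y.s Y.leaf := rfl
  rw [trOf_apply_ιMulti hmn, trOf_apply_ιMulti rfl, trOf_apply_ιMulti rfl, form_prod]
  have h1 : (Fin.append (fun i => X.toObj.inlL Y.toObj (x i)) (fun j => X.toObj.inrL Y.toObj (y j)))
      ∘ ⇑(finCongr hmn)
      = Fin.append (fun i => X.toObj.inlL Y.toObj (x i)) (fun j => X.toObj.inrL Y.toObj (y j)) :=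
    funext fun i => congrArg _ (Fin.ext rfl)
  have h2 : (x ∘ ⇑(finCongr (rfl : sdeg X.s X.leaf = sdeg X.s X.leaf))) = x :=
    funext fun i => congrArg _ (Fin.ext rfl)
  have h3 : (y ∘ ⇑(finCongr (rfl : sdeg Y.s Y.leaf = sdeg Y.s Y.leaf))) = y :=
    funext fun i => congrArg _ (Fin.ext rfl)
  rw [h1, h2, h3]
  exact prodForm_append (form X) (form Y) x y

end

end HodgeCM.ToyG2
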